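import Summits.SmoothPoincare4.SmoothPoincare4.Theorems.AcyclicBisectionExists.Negative.Gluing
import Literature.Topology.FourManifolds.HomotopySpheresSignatureKilling
import Literature.AlgebraicTopology.SingularHomology.ExcisionMayerVietorisProofs
import Literature.AlgebraicTopology.SingularHomology.SphereHomology
import Literature.AlgebraicTopology.SingularHomology.ClopenAdditivity

/-!
# `AcyclicBisectionExists` — negative-side support (3/5): homology control on ONE half suffices;
# connectedness bookkeeping

* §8 `Witness.acyclicRight_of_acyclicLeft_of_homotopyEquiv`: over `M ≃ₕ S⁴` with both halves
  connected, `W₁` ℚ-acyclic ⇒ `W₂` ℚ-acyclic (degrees 1, 2 from the pair sequence of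
  `(M, e₂W₂)` + Lefschetz vanishing on `W₁`; degree 3 by the dimension count
  `H₄(M) ≅ ℚ ↪ H₄(M, e₂W₂) ≅ H₄(W₁, ∂W₁) ≅ H⁰(W₁) ≅ ℚ`; degrees `≥ 4` via the external collar,
  Hatcher Prop 3.29); `connectedSpace_extCollar`.
* §9 `pointClass` / `preconnectedSpace_of_pointClass_eq` (`H₀` detects components, clopen
  additivity), `Witness.connectedSpace_bd₁` (`W₁` connected and ℚ-acyclic ⇒ `∂W₁` connected),
  `isConnected_seam`, `seamHomeomorph : ∂W₁ ≃ₜ ∂W₂`, `connectedSpace₂`, and the final one-sided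
  form `acyclicRight_of_acyclicLeft_of_homotopyEquiv'` (only `[ConnectedSpace W₁]` assumed).
-/

noncomputable section

-- the prescribed namespace `Summit.<P>.<Sub>.…` duplicates `SmoothPoincare4` (P = Sub)
set_option linter.dupNamespace false

open scoped Manifold ContDiff Topology ContinuousMap
open Set Function CategoryTheory CategoryTheory.Limits
open Literature.Geometry.Symplectic Literature.AlgebraicTopology.SingularHomology

namespace Summit.SmoothPoincare4.SmoothPoincare4.Theorems.AcyclicBisectionExists.Negative

open Summit.SmoothPoincare4.SmoothPoincare4.Theses.ConvexBisection

/-- Local notation: the model space `ℝ⁴`. -/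
local notation "𝔼4" => EuclideanSpace ℝ (Fin 4)
/-- Local notation: the round 4-sphere. -/
local notation "𝕊⁴" => (Metric.sphere (0 : EuclideanSpace ℝ (Fin 5)) 1)

/-! ## §8 Homology control on ONE half suffices (gen-1 near-miss `isZero_homology_right_of_left`)

Over an `M` with the ℚ-homology of `S⁴`, if `W₁` is ℚ-acyclic then so is `W₂`, provided both
halves are connected: degrees `1, 2` from the pair sequence of `(M, e₂ W₂)` and Lefschetz
vanishing on `W₁`; degree `3` by a dimension count `H₄(M) ≅ ℚ ↪ H₄(M, e₂W₂) ≅ H₄(W₁, ∂W₁) ≅ H⁰(W₁) ≅ ℚ`;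
degrees `≥ 4` because a connected manifold with nonempty boundary has no homology from the top
dimension on (external collar + Hatcher Prop 3.29). -/

section ExtCollarConnected

open Literature.AlgebraicTopology.SingularHomology

/-- The external collar of a connected space is connected (every point is joined to `W` by the
squeeze homotopy). [folklore] -/
theorem connectedSpace_extCollar (n : ℕ) (W : Type) [TopologicalSpace W]
    [ChartedSpace (EuclideanHalfSpace (n + 1)) W] [ConnectedSpace W] : ConnectedSpace (ExtCollar n W) := by
  let x₀ : ExtCollar n W := ExtCollar.incl n (Classical.arbitrary W)
  let T : ExtCollar n W → Set (ExtCollar n W) := fun x =>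
    range (ExtCollar.incl n) ∪ range (fun t : unitInterval => ExtCollar.squeezeHomotopy (t, x))
  have hT : ∀ x, IsPreconnected (T x) := fun x =>
    IsPreconnected.union (ExtCollar.incl n (ExtCollar.base x)) ⟨_, rfl⟩
      ⟨0, ExtCollar.squeezeHomotopy.apply_zero x⟩
      (isPreconnected_range ExtCollar.continuous_incl)
      (isPreconnected_range (ExtCollar.squeezeHomotopy.continuous.comp
        (continuous_id.prodMk continuous_const)))
  have hcover : ⋃₀ (range T) = univ := by
    refine eq_univ_of_forall fun x => ⟨T x, ⟨x, rfl⟩, Or.inr ⟨1, ?_⟩⟩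
    exact ExtCollar.squeezeHomotopy.apply_one x
  rw [connectedSpace_iff_univ, ← hcover]
  refine ⟨⟨x₀, T x₀, ⟨x₀, rfl⟩, Or.inl ⟨_, rfl⟩⟩, isPreconnected_sUnion x₀ _ ?_ ?_⟩
  · rintro _ ⟨x, rfl⟩; exact Or.inl ⟨_, rfl⟩
  · rintro _ ⟨x, rfl⟩; exact hT x

end ExtCollarConnected

namespace Witness

open Literature.Topology.FourManifolds

variable {M : Type} [TopologicalSpace M] [ChartedSpace 𝔼4 M] (B : Witness M)

/-- **No homology from the top dimension on**: `Hₖ(W₂; G) = 0` for `k ≥ 4` when `W₂` is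
connected, over a nonempty `M` (so `∂W₂ ≠ ∅`): `W₂ ≃ W₂ ∪ collar` (`homotopyEquivExtCollar`),
a connected NON-COMPACT 4-manifold (`ExtCollar.noncompactSpace_of_nonempty_boundary`), whose
homology vanishes from degree 4 on (Hatcher Prop 3.29, tree
`clocalHomology.isZero_singularHomology_of_noncompact`). [folklore] -/
theorem isZero_homology₂_of_four_le [T2Space M] [Nonempty M] [ConnectedSpace B.W₂] {k : ℕ}
    (hk : 4 ≤ k) : IsZero (singularHomology ℚ ℚ B.W₂ k) := by
  haveI := B.t2Space₂
  haveI : NoncompactSpace (ExtCollar 3 B.W₂) :=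
    ExtCollar.noncompactSpace_of_nonempty_boundary B.boundaries_nonempty.2
  haveI : ConnectedSpace (ExtCollar 3 B.W₂) := connectedSpace_extCollar 3 B.W₂
  exact (clocalHomology.isZero_singularHomology_of_noncompact ℚ ℚ (X := ExtCollar 3 B.W₂)
    (n := 3 + 1) hk).of_iso (singularHomology.isoOfHomotopyEquiv ℚ ℚ (homotopyEquivExtCollar 3 B.W₂) k)

variable [T2Space M] [SecondCountableTopology M] [IsManifold (𝓡 4) ∞ M] [Nonempty M]

/-- Degrees `1, 2`: if `W₁` is ℚ-acyclic and `Hₖ(M; ℚ) = 0` (`k = 1, 2`) then `Hₖ(W₂; ℚ) = 0`,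
from the exact `Hₖ₊₁(M, e₂W₂) → Hₖ(e₂W₂) → Hₖ(M)` and
`Hₖ₊₁(M, e₂W₂) ≅ Hₖ₊₁(W₁, ∂W₁) = 0` (Lefschetz vanishing on `W₁`). [folklore] -/
theorem isZero_homology₂_low (h₁ : B.AcyclicLeft) {k : ℕ} (hk : 0 < k) (hk2 : k ≤ 2)
    (hM : IsZero (singularHomology ℚ ℚ M k)) : IsZero (singularHomology ℚ ℚ B.W₂ k) := by
  refine IsZero.of_iso ?_ (singularHomology.mapIso ℚ ℚ B.emb₂.isEmbedding.toHomeomorph k)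
  haveI := B.swap.isIso_relMap₂ ℚ ℚ (k + 1)
  have hrel : IsZero (relativeSingularHomology ℚ ℚ M (range B.e₂) (k + 1)) :=
    (B.isZero_relHomology₁ h₁ (p := 3 - k) (q := k + 1) (by omega) (by omega)).of_iso
      (asIso (relativeSingularHomology.map ℚ ℚ B.swap.e₂CM B.swap.mapsTo_e₂_boundary (k + 1))).symm
  exact (relativeSingularHomology.exact_δ_map ℚ ℚ (range B.e₂) k).isZero_of_both_zeros
    (hrel.eq_of_src _ _) (hM.eq_of_tgt _ _)

/-- `dim_ℚ H₄(M, e₂W₂; ℚ) = 1` when `W₁` is connected: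
`H₄(M, e₂W₂) ≅ H₄(W₁, ∂W₁) ≅ H⁰(W₁; ℚ)` (gluing iso, Lefschetz on `W₁`) and
`dim H⁰ = dim H₀ = 1` (field UCT, `W₁` path connected). [folklore] -/
theorem finrank_relHomology_four [ConnectedSpace B.W₁] :
    Module.finrank ℚ (relativeSingularHomology ℚ ℚ M (range B.e₂) 4) = 1 := by
  haveI := B.t2Space₁
  -- `H₄(W₁, ∂W₁) ≅ H₄(M, e₂W₂)`
  haveI := B.swap.isIso_relMap₂ ℚ ℚ 4
  have e1 : relativeSingularHomology ℚ ℚ B.W₁ ((𝓡∂ 4).boundary B.W₁) 4 ≃ₗ[ℚ]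
      relativeSingularHomology ℚ ℚ M (range B.e₂) 4 :=
    (asIso (relativeSingularHomology.map ℚ ℚ B.swap.e₂CM B.swap.mapsTo_e₂_boundary 4)).toLinearEquiv
  rw [← e1.finrank_eq]
  -- Lefschetz on `W₁`: `H⁰(W₁; ℚ) ≃ H₄(W₁, ∂W₁; ℚ)`
  obtain ⟨zq, hbij⟩ := B.swap.exists_lefschetz₂ (p := 0) (q := 2 + 1 + 1) rfl
  rw [← (LinearEquiv.ofBijective ((relCapProduct (M := ℚ) ((𝓡∂ (2 + 1 + 1)).boundary B.W₁)
    (show 0 + (2 + 1 + 1) = 2 + 1 + 1 from rfl)).flip zq) hbij).finrank_eq]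
  -- `dim H⁰(W₁; ℚ) = dim H₀(W₁; ℚ) = 1`
  rw [finrank_singularCohomology_eq_bettiNumber_of_field ℚ B.W₁ 0, bettiNumber]
  haveI : LocallyPathConnectedSpace B.W₁ :=
    ChartedSpace.locallyPathConnectedSpace (EuclideanHalfSpace 4) B.W₁
  haveI : PathConnectedSpace B.W₁ := pathConnectedSpace_iff_connectedSpace.mpr ‹_›
  haveI := singularHomology.isIso_ε_of_pathConnectedSpace ℚ ℚ (X := B.W₁)
  rw [(asIso (singularHomology.ε ℚ ℚ B.W₁)).toLinearEquiv.finrank_eq]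
  change Module.finrank ℚ (ULift.{0} ℚ) = 1
  rw [ULift.moduleEquiv.finrank_eq, Module.finrank_self]

/-- Degree `3`: if `H₃(M; ℚ) = 0`, `dim H₄(M; ℚ) = 1` and both halves are connected then
`H₃(W₂; ℚ) = 0` — `j : H₄(M) → H₄(M, e₂W₂)` is injective (`H₄(e₂W₂) = 0`) between
1-dimensional spaces, hence onto, so `∂ : H₄(M, e₂W₂) → H₃(e₂W₂)` vanishes while being onto
(`H₃(M) = 0`). [folklore] -/
theorem isZero_homology₂_three [ConnectedSpace B.W₁] [ConnectedSpace B.W₂]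
    (hM3 : IsZero (singularHomology ℚ ℚ M 3))
    (hM4 : Module.finrank ℚ (singularHomology ℚ ℚ M 4) = 1) :
    IsZero (singularHomology ℚ ℚ B.W₂ 3) := by
  have eA : B.W₂ ≃ₜ ↥(range B.e₂) := B.emb₂.isEmbedding.toHomeomorph
  -- `j` is injective
  have hA4 : IsZero (singularHomology ℚ ℚ ↥(range B.e₂) 4) :=
    (B.isZero_homology₂_of_four_le le_rfl).of_iso (singularHomology.mapIso ℚ ℚ eA 4).symm
  have hmono : Mono (relativeSingularHomology.ofAbsolute ℚ ℚ M (range B.e₂) 4) :=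
    (relativeSingularHomology.exact_map_ofAbsolute ℚ ℚ (range B.e₂) 4).mono_g (hA4.eq_of_src _ _)
  have hinj := (ModuleCat.mono_iff_injective _).mp hmono
  -- hence onto, by the dimension count
  have hfin := B.finrank_relHomology_four
  haveI : Module.Finite ℚ (singularHomology ℚ ℚ M 4) := Module.finite_of_finrank_eq_succ hM4
  haveI : Module.Finite ℚ (relativeSingularHomology ℚ ℚ M (range B.e₂) 4) :=
    Module.finite_of_finrank_eq_succ hfin
  have hsurj : Function.Surjective (relativeSingularHomology.ofAbsolute ℚ ℚ M (range B.e₂) 4).hom :=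
    (LinearMap.injective_iff_surjective_of_finrank_eq_finrank (by rw [hM4, hfin])).mp hinj
  haveI : Epi (relativeSingularHomology.ofAbsolute ℚ ℚ M (range B.e₂) 4) :=
    (ModuleCat.epi_iff_surjective _).mpr hsurj
  have hδ : relativeSingularHomology.δ ℚ ℚ M (range B.e₂) 3 = 0 :=
    zero_of_epi_comp (relativeSingularHomology.ofAbsolute ℚ ℚ M (range B.e₂) 4)
      (relativeSingularHomology.ofAbsolute_comp_δ ℚ ℚ (range B.e₂) 3)
  -- so `H₃(e₂ W₂) = 0`
  have hA3 : IsZero (singularHomology ℚ ℚ ↥(range B.e₂) 3) :=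
    (relativeSingularHomology.exact_δ_map ℚ ℚ (range B.e₂) 3).isZero_of_both_zeros hδ
      (hM3.eq_of_tgt _ _)
  exact hA3.of_iso (singularHomology.mapIso ℚ ℚ eA 3)

/-- **Homology control on one half suffices.**  Over an `M` with the ℚ-homology of `S⁴` in
degrees `1 … 4` and with both halves connected, `W₁` ℚ-acyclic ⇒ `W₂` ℚ-acyclic.  (Provers:
the conjunct `IsZero (H_k W₂)` of the crux is then free; planners: a one-sided restatement is
equivalent modulo connectedness.) [folklore] -/
theorem acyclicRight_of_acyclicLeft [ConnectedSpace B.W₁] [ConnectedSpace B.W₂] (h₁ : B.AcyclicLeft)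
    (hM : ∀ k, 0 < k → k ≤ 3 → IsZero (singularHomology ℚ ℚ M k))
    (hM4 : Module.finrank ℚ (singularHomology ℚ ℚ M 4) = 1) : B.AcyclicRight := by
  intro k hk
  rcases Nat.lt_or_ge k 3 with h | h
  · exact B.isZero_homology₂_low h₁ hk (by omega) (hM k hk (by omega))
  rcases Nat.lt_or_ge k 4 with h' | h'
  · obtain rfl : k = 3 := by omega
    exact B.isZero_homology₂_three (hM 3 (by norm_num) le_rfl) hM4
  · exact B.isZero_homology₂_of_four_le h'

omit [ChartedSpace 𝔼4 M] [T2Space M] [SecondCountableTopology M] [IsManifold (𝓡 4) ∞ M] [Nonempty M] in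
/-- The ℚ-homology of a homotopy 4-sphere: `Hₖ(M; ℚ) = 0` for `0 < k`, `k ≠ 4` (tree
`isZero_singularHomology_sphere_holds`, Hatcher Cor 2.14, transported by homotopy invariance).
[folklore] -/
theorem isZero_homology_of_homotopyEquiv_sphere (e : M ≃ₕ 𝕊⁴) {k : ℕ} (hk : k ≠ 0) (hk4 : k ≠ 4) :
    IsZero (singularHomology ℚ ℚ M k) :=
  (isZero_singularHomology_sphere_holds ℚ ℚ (n := 4) hk hk4).of_iso
    (singularHomology.isoOfHomotopyEquiv ℚ ℚ e k)

omit [ChartedSpace 𝔼4 M] [T2Space M] [SecondCountableTopology M] [IsManifold (𝓡 4) ∞ M] [Nonempty M] in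
/-- `dim H₄(M; ℚ) = 1` for a homotopy 4-sphere (tree `singularHomologyUnitSphereIso`). [folklore] -/
theorem finrank_homology_four_of_homotopyEquiv_sphere (e : M ≃ₕ 𝕊⁴) :
    Module.finrank ℚ (singularHomology ℚ ℚ M 4) = 1 := by
  rw [(singularHomology.isoOfHomotopyEquiv ℚ ℚ e 4 ≪≫
    singularHomologyUnitSphereIso ℚ ℚ 4 (by norm_num)).toLinearEquiv.finrank_eq]
  exact Module.finrank_self ℚ

/-- **In the crux's own setting (`M ≃ₕ S⁴`), the ℚ-acyclicity of `W₂` follows from that of `W₁`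
once both halves are connected.** [folklore] -/
theorem acyclicRight_of_acyclicLeft_of_homotopyEquiv (e : M ≃ₕ 𝕊⁴) [ConnectedSpace B.W₁]
    [ConnectedSpace B.W₂] (h₁ : B.AcyclicLeft) : B.AcyclicRight :=
  B.acyclicRight_of_acyclicLeft h₁
    (fun k hk hk3 => isZero_homology_of_homotopyEquiv_sphere e (by omega) (by omega))
    (finrank_homology_four_of_homotopyEquiv_sphere e)

end Witness

/-! ## §9 Connectedness bookkeeping: `W₁` connected and ℚ-acyclic ⇒ seam connected ⇒ `W₂`
connected (removes the hypothesis `[ConnectedSpace W₂]` of §8 and proves the "connected" half of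
the crux's gloss "seam a connected ℚHS³") -/

section HZero

open Literature.AlgebraicTopology.SingularHomology

variable {Z Y : Type} [TopologicalSpace Z] [TopologicalSpace Y]

/-- The class of a point in `H₀(Z; ℚ)`: the image of the generator `ε⁻¹(1)` of `H₀(pt; ℚ)`.
[folklore] -/
def pointClass (z : Z) : singularHomology ℚ ℚ Z 0 :=
  haveI := singularHomology.isIso_ε_of_pathConnectedSpace ℚ ℚ (X := PUnit.{1})
  singularHomology.map ℚ ℚ (ContinuousMap.const PUnit.{1} z) 0
    (inv (singularHomology.ε ℚ ℚ PUnit.{1}) (ULift.up 1))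

/-- `ε [z] = 1`. [folklore] -/
theorem ε_pointClass (z : Z) : singularHomology.ε ℚ ℚ Z (pointClass z) = ULift.up 1 := by
  haveI := singularHomology.isIso_ε_of_pathConnectedSpace ℚ ℚ (X := PUnit.{1})
  change (singularHomology.map ℚ ℚ (ContinuousMap.const PUnit.{1} z) 0 ≫ singularHomology.ε ℚ ℚ Z)
    (inv (singularHomology.ε ℚ ℚ PUnit.{1}) (ULift.up 1)) = _
  rw [singularHomology.map_ε]
  change (inv (singularHomology.ε ℚ ℚ PUnit.{1}) ≫ singularHomology.ε ℚ ℚ PUnit.{1}) _ = _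
  rw [IsIso.inv_hom_id]
  rfl

/-- `f_* [z] = [f z]`. [folklore] -/
theorem map_pointClass (f : C(Z, Y)) (z : Z) :
    singularHomology.map ℚ ℚ f 0 (pointClass z) = pointClass (f z) := by
  unfold pointClass
  change (singularHomology.map ℚ ℚ (ContinuousMap.const PUnit.{1} z) 0 ≫ singularHomology.map ℚ ℚ f 0) _ = _
  rw [← singularHomology.map_comp]
  rfl

/-- In a path-connected space all point classes agree (`ε` is an isomorphism). [folklore] -/
theorem pointClass_eq_of_pathConnectedSpace [PathConnectedSpace Z] (z z' : Z) :
    pointClass z = pointClass z' := by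
  haveI := singularHomology.isIso_ε_of_pathConnectedSpace ℚ ℚ (X := Z)
  apply ((ModuleCat.mono_iff_injective (singularHomology.ε ℚ ℚ Z)).mp inferInstance)
  rw [ε_pointClass, ε_pointClass]

/-- **`H₀` detects components**: if all point classes of a locally connected space `Z` agree in
`H₀(Z; ℚ)`, then `Z` is preconnected (clopen additivity of `H₀`, Hatcher Prop 2.6, tree
`singularHomology.eq_zero_of_sum_map_subsetIncl_eq_zero`). [folklore] -/
theorem preconnectedSpace_of_pointClass_eq [LocallyConnectedSpace Z]
    (h : ∀ z z' : Z, pointClass z = pointClass z') : PreconnectedSpace Z := by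
  rw [preconnectedSpace_iff_connectedComponent]
  intro z₀
  by_contra hU
  obtain ⟨z₁, hz₁⟩ : ∃ z₁, z₁ ∉ connectedComponent z₀ := (Set.ne_univ_iff_exists_notMem _).mp hU
  -- the clopen partition `{C, Cᶜ}`, `C` the component of `z₀`
  let A : Bool → Set Z := fun b => bif b then connectedComponent z₀ else (connectedComponent z₀)ᶜ
  have hA : IsClopenPartition A :=
    { isOpen := fun b => by
        cases b
        · exact isClosed_connectedComponent.isOpen_compl
        · exact isOpen_connectedComponent
      disjoint := fun j k hjk => by
        cases j <;> cases k
        · exact (hjk rfl).elim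
        · exact disjoint_compl_left
        · exact disjoint_compl_right
        · exact (hjk rfl).elim
      exists_mem := fun z => by
        by_cases hz : z ∈ connectedComponent z₀
        · exact ⟨true, hz⟩
        · exact ⟨false, hz⟩ }
  let x : ∀ b, singularHomology ℚ ℚ (A b) 0 := fun b =>
    match b with
    | true => pointClass (⟨z₀, mem_connectedComponent⟩ : A true)
    | false => -pointClass (⟨z₁, hz₁⟩ : A false)
  have hsum : ∑ b ∈ Finset.univ, singularHomology.map ℚ ℚ (subsetIncl (A b)) 0 (x b) = 0 := by
    rw [Finset.sum_eq_add_of_mem (a := true) (b := false) (Finset.mem_univ _) (Finset.mem_univ _)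
      (by decide) (fun c _ hc => by cases c <;> simp at hc)]
    change singularHomology.map ℚ ℚ (subsetIncl (A true)) 0 (pointClass _) +
      singularHomology.map ℚ ℚ (subsetIncl (A false)) 0 (-pointClass _) = 0
    rw [map_neg, map_pointClass, map_pointClass, h _ z₁]
    exact add_neg_cancel _
  have hx := singularHomology.eq_zero_of_sum_map_subsetIncl_eq_zero (R := ℚ) (M := ℚ) hA 0
    Finset.univ x hsum true (Finset.mem_univ _)
  have key := congrArg (singularHomology.ε ℚ ℚ (A true)) hx
  change singularHomology.ε ℚ ℚ (A true) (pointClass _) = _ at key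
  rw [ε_pointClass, map_zero] at key
  exact one_ne_zero (congrArg ULift.down key)

end HZero

namespace Witness

open Literature.Topology.FourManifolds

variable {M : Type} [TopologicalSpace M] [ChartedSpace 𝔼4 M] (B : Witness M)

/-- The boundary identification as a CONTINUOUS map: `e₂⁻¹ ∘ e₁` on `∂W₁`. [folklore] -/
theorem continuous_seamMap : Continuous B.seamMap := by
  let g : B.Bd₁ → B.W₂ := fun z =>
    B.emb₂.isEmbedding.toHomeomorph.symm ⟨B.e₁ z, B.seam_subset_range_e₂
      (by rw [seam_eq_image₁]; exact mem_image_of_mem _ z.2)⟩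
  have hg : Continuous g := B.emb₂.isEmbedding.toHomeomorph.symm.continuous.comp
    ((B.continuous_e₁.comp continuous_subtype_val).subtype_mk _)
  have hge : ∀ z, B.e₂ (g z) = B.e₁ z := fun z => by
    change ((B.emb₂.isEmbedding.toHomeomorph (B.emb₂.isEmbedding.toHomeomorph.symm _)) : M) = _
    rw [Homeomorph.apply_symm_apply]
  have heq : B.seamMap = fun z => ⟨g z, B.mem_boundary₂_of_mem_range (g z) ⟨z, (hge z).symm⟩⟩ := by
    funext z
    exact Subtype.ext (B.injective_e₂ ((B.e₂_seamMap z).trans (hge z).symm))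
  rw [heq]
  exact hg.subtype_mk _

/-- **The seam identification `∂W₁ ≃ₜ ∂W₂` is a homeomorphism.** [folklore] -/
def seamHomeomorph : B.Bd₁ ≃ₜ B.Bd₂ where
  toEquiv := B.seamEquiv
  continuous_toFun := B.continuous_seamMap
  continuous_invFun := B.swap.continuous_seamMap

variable [T2Space M] [SecondCountableTopology M] [Nonempty M]

/-- **`W₁` connected and ℚ-acyclic ⇒ `∂W₁` connected**: `H₁(W₁, ∂W₁; ℚ) = 0` (Lefschetz) makes
`H₀(∂W₁) → H₀(W₁) ≅ ℚ` injective, so all point classes of `∂W₁` agree, and `H₀` detects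
components (`preconnectedSpace_of_pointClass_eq`). [folklore] -/
theorem connectedSpace_bd₁ [ConnectedSpace B.W₁] (h₁ : B.AcyclicLeft) : ConnectedSpace B.Bd₁ := by
  haveI := B.t2Space₁
  haveI : LocallyPathConnectedSpace B.W₁ :=
    ChartedSpace.locallyPathConnectedSpace (EuclideanHalfSpace 4) B.W₁
  haveI : PathConnectedSpace B.W₁ := pathConnectedSpace_iff_connectedSpace.mpr ‹_›
  haveI : LocallyPathConnectedSpace B.Bd₁ :=
    ChartedSpace.locallyPathConnectedSpace (EuclideanSpace ℝ (Fin 3)) B.Bd₁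
  haveI : Nonempty B.Bd₁ := let ⟨w, hw⟩ := B.boundaries_nonempty.1; ⟨⟨w, hw⟩⟩
  -- `H₀(∂W₁) → H₀(W₁)` is injective
  have hrel := B.isZero_relHomology₁ h₁ (p := 3) (q := 1) (by norm_num) rfl
  have hmono : Mono (singularHomology.map ℚ ℚ
      (⟨Subtype.val, continuous_subtype_val⟩ : C(B.Bd₁, B.W₁)) 0) :=
    (relativeSingularHomology.exact_δ_map ℚ ℚ ((𝓡∂ 4).boundary B.W₁) 0).mono_g (hrel.eq_of_src _ _)
  have hinj := (ModuleCat.mono_iff_injective _).mp hmono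
  haveI : PreconnectedSpace B.Bd₁ := preconnectedSpace_of_pointClass_eq fun z z' => hinj (by
    rw [map_pointClass, map_pointClass]
    exact pointClass_eq_of_pathConnectedSpace _ _)
  exact ⟨‹_›⟩

/-- **… ⇒ the seam is connected.** [folklore] -/
theorem isConnected_seam [ConnectedSpace B.W₁] (h₁ : B.AcyclicLeft) : IsConnected B.seam := by
  haveI := B.connectedSpace_bd₁ h₁
  have : B.seam = range (B.e₁ ∘ Subtype.val : B.Bd₁ → M) := by
    rw [B.seam_eq_image₁, range_comp, Subtype.range_coe]
  rw [this]
  exact isConnected_range (B.continuous_e₁.comp continuous_subtype_val)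

/-- **… ⇒ `W₂` is connected** (the seam is `∂W₂` up to the homeomorphism `seamHomeomorph`, and a
Stein domain with connected boundary is connected: tree
`SteinStructure.preconnectedSpace_of_isPreconnected_boundary`, maximum principle). [folklore] -/
theorem connectedSpace₂ [ConnectedSpace B.W₁] (h₁ : B.AcyclicLeft) : ConnectedSpace B.W₂ := by
  haveI := B.connectedSpace_bd₁ h₁
  haveI := B.t2Space₂
  haveI : ConnectedSpace B.Bd₂ := B.seamHomeomorph.surjective.connectedSpace B.seamHomeomorph.continuous
  haveI : PreconnectedSpace B.W₂ := B.J₂.preconnectedSpace_of_isPreconnected_boundary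
    (isPreconnected_iff_preconnectedSpace.mpr inferInstance)
  exact ⟨B.halves_nonempty.2⟩

/-- **Final form of §8: homology control AND connectedness on one half suffice.**  Over
`M ≃ₕ S⁴`, if `W₁` is connected and ℚ-acyclic then `W₂` is (connected and) ℚ-acyclic. [folklore] -/
theorem acyclicRight_of_acyclicLeft_of_homotopyEquiv' [IsManifold (𝓡 4) ∞ M] (e : M ≃ₕ 𝕊⁴)
    [ConnectedSpace B.W₁] (h₁ : B.AcyclicLeft) : B.AcyclicRight := by
  haveI := B.connectedSpace₂ h₁
  exact B.acyclicRight_of_acyclicLeft_of_homotopyEquiv e h₁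

end Witness


end Summit.SmoothPoincare4.SmoothPoincare4.Theorems.AcyclicBisectionExists.Negative
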